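import Literature.Barriers.FinalStateConjecture.ExtremalHorizonNEnergyUniformBound
import Literature.Barriers.FinalStateConjecture.ExtremalHorizonAxisymmetricBox
import Literature.Barriers.FinalStateConjecture.ExtremalHorizonPointwiseDecayFromEnergy
import HarnessLib

/-!
# Aretakis's pointwise decay on extremal Kerr from integrated local energy decay on the
# transition slab (Aretakis 2012, Thm. 5 ⇐ Thm. 1 restricted to `{23M/21 ≤ r ≤ 8M/7}`)

(family `gr`; proving seat of `Literature.Barriers.FinalStateConjecture.Aretakis2012_pointwiseDecay`
— Aretakis, JFA 263 (2012), Thm. 5. The chain of this seat: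
`ExtremalHorizonSphereSobolev` (Sobolev on the horizon spheres, §15, Lemma 15.0.1) →
`ExtremalHorizonCarterOperator` (Carter's operator, the separated equation) →
`ExtremalHorizonShellEnergyDecay`, `ExtremalHorizonPointwiseDecayFromEnergy` (pointwise decay from
uniform boundedness + integrated decay of the near-horizon energies) →
`KerrStarEnergyIdentity`, `ExtremalHorizonTEnergy` (conservation of the degenerate energy, §5) →
`KerrStarMultiplierIdentity`, `ExtremalHorizonMultiplierIdentity` (the vector field method, §8) →
`KerrStarHorizonCurrent` (the current `J^{N,−1/2}`, Prop. 7.2.1) → `KerrStarHorizonEnergyEstimate`,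
`ExtremalHorizonNEnergyEstimate`, `ExtremalHorizonNEnergyBound`, `KerrStarHorizonFluxBound`,
`ExtremalHorizonNEnergyUniformBound` (§13.1: uniform boundedness of the `N`-energy near `𝓗⁺`
modulo the transition slab) → this file. What is NOT proved here is the integrated local energy
decay estimate, Thm. 1 of the source (§§8–12: Fourier/oblate-spheroidal separation and microlocal
currents at the trapped frequencies); it enters only through the hypothesis of the final theorem,
restricted to the compact slab `{23M/21 ≤ r ≤ 8M/7}` away from the horizon and from the trapped
set.)

* `Kerr.intervalIntegral_sq_le_boundary` — first Hardy inequality with boundary term;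
  `Kerr.line_sq_slab_poincare` — `∫_M^{23M/21} g² ≤ 6∫_{slab} g² + 4∫_M^{23M/21}(x−M)²g'² + 4∫_{slab}(x−M)²g'²`;
* dictionary `Kerr.starPull_boxPoint_eq`, `Kerr.pd_one_starPull_boxPoint`;
* `Kerr.box_sq_weighted_le` — the degenerate zeroth-order slice near `𝓗⁺` by the slab and the
  coercive bulk; `Kerr.nearSq_le_tEnergy`; `Kerr.continuous_densities`, `Kerr.continuous_boxSlice`;
* `Kerr.tEnergy_data_far_eq` — the data energy does not see beyond the support;
* `Kerr.horizon_bounds_of_class`, `Kerr.integrable_slices_of_class`, `Kerr.apexHypotheses_of_class` —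
  for the class, a slab bound gives the two hypotheses of
  `Aretakis2012_pointwiseDecay_of_uniformBoundedness_of_integratedDecay` (`R₂ = 23M/21`, `τ₀ = 0`);
* `Aretakis2012_pointwiseDecay_of_slabILED` (**the reduction**) and
  `Aretakis2012_pointwiseDecay_of_slabILED'` (the same with the slab hypothesis written with `ψ` and its
  frame derivatives at the points of the Kerr–Schild chart).

Everything is proved; no named facts.

## References

* S. Aretakis, *Decay of axisymmetric solutions of the wave equation on extreme Kerr backgrounds*,
  J. Funct. Anal. 263 (2012) 2770–2831 (arXiv:1110.2006): Thm. 1 (integrated decay), Thm. 2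
  (uniform boundedness), Thm. 5 and §15 (pointwise decay), §4.4, §13.1 (key `Aretakis2012`).
-/

noncomputable section

open Real Set Filter MeasureTheory intervalIntegral
open scoped Topology ContDiff Manifold

namespace Literature.Barriers.FinalStateConjecture.Kerr

open Literature.Geometry.Lorentzian
open Literature.Geometry.Lorentzian.Kerr.StarCoord

/-! ### One-dimensional inequalities -/

/-- **First Hardy inequality with boundary term**: for `g ∈ C¹[a, b]`,
`∫_a^b g² ≤ 2(b − a) g(b)² + 4 ∫_a^b (x − a)² g'²`. [cite: Aretakis2012, §4.4] -/
theorem intervalIntegral_sq_le_boundary {g g' : ℝ → ℝ} {a b : ℝ} (hab : a ≤ b)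
    (hg : ∀ x ∈ Icc a b, HasDerivAt g (g' x) x) (hg' : ContinuousOn g' (Icc a b)) :
    ∫ x in a..b, g x ^ 2 ≤ 2 * (b - a) * g b ^ 2 + 4 * ∫ x in a..b, (x - a) ^ 2 * g' x ^ 2 := by
  have hgc : ContinuousOn g (Icc a b) := fun x hx ↦ (hg x hx).continuousAt.continuousWithinAt
  have hfun : (fun x ↦ (x - a) * g x ^ 2) = fun x ↦ (x - a) * (g x * g x) := by
    funext x; ring
  have hprod : ∀ x ∈ uIcc a b, HasDerivAt (fun x ↦ (x - a) * g x ^ 2)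
      (g x ^ 2 + 2 * (x - a) * g x * g' x) x := by
    intro x hx
    rw [uIcc_of_le hab] at hx
    have h1 : HasDerivAt (fun x : ℝ ↦ x - a) 1 x := (hasDerivAt_id x).sub_const a
    have h := h1.fun_mul ((hg x hx).fun_mul (hg x hx))
    rw [hfun]
    refine h.congr_deriv ?_
    ring
  have hi1 : IntervalIntegrable (fun x ↦ g x ^ 2) volume a b := (hgc.pow 2).intervalIntegrable_of_Icc hab
  have hi2 : IntervalIntegrable (fun x ↦ 2 * (x - a) * g x * g' x) volume a b :=
    (((continuousOn_const.mul (continuousOn_id.sub continuousOn_const)).mul hgc).mul hg').intervalIntegrable_of_Icc hab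
  have hi3 : IntervalIntegrable (fun x ↦ (x - a) ^ 2 * g' x ^ 2) volume a b :=
    (((continuousOn_id.sub continuousOn_const).pow 2).mul (hg'.pow 2)).intervalIntegrable_of_Icc hab
  have hftc := intervalIntegral.integral_eq_sub_of_hasDerivAt hprod (hi1.add hi2)
  simp only [sub_self, zero_mul, sub_zero] at hftc
  rw [intervalIntegral.integral_add hi1 hi2] at hftc
  have hpt : ∫ x in a..b, -(2 * (x - a) * g x * g' x) ≤ ∫ x in a..b, (1 / 2 * g x ^ 2 + 2 * ((x - a) ^ 2 * g' x ^ 2)) := by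
    refine intervalIntegral.integral_mono_on hab hi2.neg ((hi1.const_mul _).add (hi3.const_mul _)) fun x _ ↦ ?_
    nlinarith [sq_nonneg (g x + 2 * (x - a) * g' x)]
  rw [intervalIntegral.integral_neg, intervalIntegral.integral_add (hi1.const_mul _) (hi3.const_mul _),
    intervalIntegral.integral_const_mul, intervalIntegral.integral_const_mul] at hpt
  nlinarith [hpt, hftc, sq_nonneg (g b), sub_nonneg.mpr hab]

/-- **Zeroth order near the horizon from the slab and the degenerate derivative (`r`-line form).**
For `g ∈ C¹[M, 8M/7]`, `M > 0`:
`∫_M^{23M/21} g² ≤ 6 ∫_{23M/21}^{8M/7} g² + 4 ∫_M^{23M/21} (x − M)² g'² + 4 ∫_{23M/21}^{8M/7} (x − M)² g'²`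
— the first Hardy inequality with boundary term on `[M, b]`, averaged over `b` in the slab.
[cite: Aretakis2012, §4.4 and §13.1] -/
theorem line_sq_slab_poincare {M : ℝ} (hM : 0 < M) {g g' : ℝ → ℝ}
    (hg : ∀ x ∈ Icc M (8 / 7 * M), HasDerivAt g (g' x) x) (hg' : ContinuousOn g' (Icc M (8 / 7 * M))) :
    ∫ x in M..(23 / 21 * M), g x ^ 2 ≤ 6 * (∫ x in (23 / 21 * M)..(8 / 7 * M), g x ^ 2) +
      4 * (∫ x in M..(23 / 21 * M), (x - M) ^ 2 * g' x ^ 2) +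
      4 * ∫ x in (23 / 21 * M)..(8 / 7 * M), (x - M) ^ 2 * g' x ^ 2 := by
  have hMN : M ≤ 23 / 21 * M := by linarith
  have hNR : 23 / 21 * M ≤ 8 / 7 * M := by linarith
  have hMR : M ≤ 8 / 7 * M := by linarith
  have hgc : ContinuousOn g (Icc M (8 / 7 * M)) := fun x hx ↦ (hg x hx).continuousAt.continuousWithinAt
  have hi1 : IntervalIntegrable (fun x ↦ g x ^ 2) volume M (8 / 7 * M) := (hgc.pow 2).intervalIntegrable_of_Icc hMR
  have hi3 : IntervalIntegrable (fun x ↦ (x - M) ^ 2 * g' x ^ 2) volume M (8 / 7 * M) :=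
    (((continuousOn_id.sub continuousOn_const).pow 2).mul (hg'.pow 2)).intervalIntegrable_of_Icc hMR
  -- for every `b` in the slab
  have hb : ∀ b ∈ Icc (23 / 21 * M) (8 / 7 * M), ∫ x in M..(23 / 21 * M), g x ^ 2 ≤
      2 / 7 * M * g b ^ 2 + 4 * ∫ x in M..(8 / 7 * M), (x - M) ^ 2 * g' x ^ 2 := by
    intro b hb
    have hMb : M ≤ b := hMN.trans hb.1
    have h1 := intervalIntegral_sq_le_boundary hMb (fun x hx ↦ hg x ⟨hx.1, hx.2.trans hb.2⟩)
      (hg'.mono (Icc_subset_Icc_right hb.2))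
    have h2 : ∫ x in M..(23 / 21 * M), g x ^ 2 ≤ ∫ x in M..b, g x ^ 2 :=
      intervalIntegral.integral_mono_interval le_rfl hMN hb.1
        (ae_of_all _ fun x ↦ sq_nonneg _) (hi1.mono_set (by rw [uIcc_of_le hMb, uIcc_of_le hMR]; exact Icc_subset_Icc_right hb.2))
    have h3 : ∫ x in M..b, (x - M) ^ 2 * g' x ^ 2 ≤ ∫ x in M..(8 / 7 * M), (x - M) ^ 2 * g' x ^ 2 :=
      intervalIntegral.integral_mono_interval le_rfl hMb hb.2
        (ae_of_all _ fun x ↦ by positivity) hi3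
    have h4 : 2 * (b - M) * g b ^ 2 ≤ 2 / 7 * M * g b ^ 2 := by
      apply mul_le_mul_of_nonneg_right _ (sq_nonneg _); linarith [hb.2]
    linarith
  -- average over `b`
  set Y : ℝ := ∫ x in M..(8 / 7 * M), (x - M) ^ 2 * g' x ^ 2 with hYdef
  have hi1g : IntervalIntegrable (fun u ↦ g u ^ 2) volume (23 / 21 * M) (8 / 7 * M) :=
    hi1.mono_set (by rw [uIcc_of_le hNR, uIcc_of_le hMR]; exact Icc_subset_Icc_left hMN)
  have hA : IntervalIntegrable (fun u ↦ 2 / 7 * M * g u ^ 2) volume (23 / 21 * M) (8 / 7 * M) := hi1g.const_mul _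
  have hB : IntervalIntegrable (fun _ ↦ 4 * Y) volume (23 / 21 * M) (8 / 7 * M) := intervalIntegrable_const
  have havg := intervalIntegral.integral_mono_on hNR intervalIntegrable_const (hA.add hB) hb
  have hRHS : ∫ u in (23 / 21 * M)..(8 / 7 * M), (2 / 7 * M * g u ^ 2 + 4 * Y) =
      2 / 7 * M * (∫ u in (23 / 21 * M)..(8 / 7 * M), g u ^ 2) + (8 / 7 * M - 23 / 21 * M) * (4 * Y) := by
    rw [intervalIntegral.integral_add hA hB, intervalIntegral.integral_const_mul, intervalIntegral.integral_const,
      smul_eq_mul]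
  rw [intervalIntegral.integral_const, smul_eq_mul, hRHS] at havg
  -- split `Y`
  have hsplit : Y = (∫ x in M..(23 / 21 * M), (x - M) ^ 2 * g' x ^ 2) +
      ∫ x in (23 / 21 * M)..(8 / 7 * M), (x - M) ^ 2 * g' x ^ 2 :=
    (intervalIntegral.integral_add_adjacent_intervals
      (hi3.mono_set (by rw [uIcc_of_le hMN, uIcc_of_le hMR]; exact Icc_subset_Icc_right hNR))
      (hi3.mono_set (by rw [uIcc_of_le hNR, uIcc_of_le hMR]; exact Icc_subset_Icc_left hMN))).symm
  have hslab : (8 / 7 * M - 23 / 21 * M) = M / 21 := by ring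
  rw [hslab] at havg
  have key : M / 21 * (∫ x in M..(23 / 21 * M), g x ^ 2) ≤
      M / 21 * (6 * (∫ x in (23 / 21 * M)..(8 / 7 * M), g x ^ 2) +
        4 * (∫ x in M..(23 / 21 * M), (x - M) ^ 2 * g' x ^ 2) +
        4 * ∫ x in (23 / 21 * M)..(8 / 7 * M), (x - M) ^ 2 * g' x ^ 2) := by
    rw [hsplit] at havg
    linarith
  exact le_of_mul_le_mul_left key (by positivity)

/-! ### Dictionary between the box and the shell languages -/

/-- `G(p(φ₀; t, r, θ)) = Φ(p(t, r, θ, φ₀))` for `G = Φ ∘ κ`. [folklore] -/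
theorem starPull_boxPoint_eq (M : ℝ) (Φ : E4 → ℝ) (φ₀ t r θ : ℝ) :
    Kerr.starPull M Φ (boxPoint φ₀ t r θ) = Φ (shellPoint M t r θ φ₀) := rfl

/-- `∂₁G(p(φ₀; t, r, θ)) = dΦ_{p(t,r,θ,φ₀)}(0, n̂)` (the transversal derivative `∂_ρ`). [folklore] -/
theorem pd_one_starPull_boxPoint {M : ℝ} {Φ : E4 → ℝ} {φ₀ t r θ : ℝ}
    (hΦ : DifferentiableAt ℝ Φ (shellPoint M t r θ φ₀)) :
    pd 1 (Kerr.starPull M Φ) (boxPoint φ₀ t r θ) =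
      fderiv ℝ Φ (shellPoint M t r θ φ₀) (E4.spaceEmbed (sphRadial θ φ₀)) := by
  rw [pd_starPull_boxPoint hΦ 1, Kerr.starFrame_one]
  rfl

/-! ### The zeroth-order term near the horizon (coordinates, `G` globally smooth) -/

section Zeroth

variable {M : ℝ} {G : E4 → ℝ}

/-- Continuity of a globally continuous density along the box map `(t, r, θ) ↦ p(0; t, r, θ)` and its
slices. [folklore] -/
theorem continuous_comp_boxPoint₃ {F : E4 → ℝ} (hF : Continuous F) (φ₀ : ℝ) :
    Continuous fun p : ℝ × ℝ × ℝ ↦ F (boxPoint φ₀ p.1 p.2.1 p.2.2) := hF.comp (continuous_boxPoint φ₀)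

/-- **The weighted zeroth-order slice near the horizon is controlled by the slab and the coercive
bulk (coordinates).** For `G ∈ C^∞(E4)`, `M > 0`, every `t`:
`∫₀^π∫_M^{23M/21} sin θ (G² + (r − M)²(∂_rG)²) ≤ (7/M) ∫₀^π∫_{23M/21}^{8M/7} slabDensity + 5 ∫₀^π∫_M^{23M/21} K_low`
(`line_sq_slab_poincare` on each `r`-line, `(r − M)² ≤ ¼(r − M)(r + M)` on `𝓐_N`).
[cite: Aretakis2012, §13.1] -/
theorem box_sq_weighted_le (hM : 0 < M) (hG : ContDiff ℝ ∞ G) (t φ₀ : ℝ) :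
    (∫ θ in (0 : ℝ)..π, ∫ r in M..(23 / 21 * M), sin θ * (G (boxPoint φ₀ t r θ) ^ 2 +
        (r - M) ^ 2 * pd 1 G (boxPoint φ₀ t r θ) ^ 2)) ≤
      7 / M * (∫ θ in (0 : ℝ)..π, ∫ r in (23 / 21 * M)..(8 / 7 * M), slabDensity M G (boxPoint φ₀ t r θ)) +
        5 * ∫ θ in (0 : ℝ)..π, ∫ r in M..(23 / 21 * M), nBulkLower M G (boxPoint φ₀ t r θ) := by
  have hπ : (0 : ℝ) ≤ π := pi_pos.le
  have hMN : M ≤ 23 / 21 * M := by linarith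
  have hNR : 23 / 21 * M ≤ 8 / 7 * M := by linarith
  have hMR : M ≤ 8 / 7 * M := by linarith
  -- continuity
  have hdiff : Differentiable ℝ G := hG.differentiable (by simp)
  have cG : Continuous G := hG.continuous
  have cpd : ∀ i, Continuous (pd i G) := fun i ↦
    (hG.continuous_fderiv (by simp)).clm_apply continuous_const
  have c3G := continuous_comp_boxPoint₃ cG φ₀
  have c3pd := fun i ↦ continuous_comp_boxPoint₃ (cpd i) φ₀
  have csd : Continuous (slabDensity M G) := by
    unfold slabDensity
    exact (continuous_sin.comp (PiLp.continuous_apply 2 _ 2)).mul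
      (((continuous_const.mul (cG.pow 2)).add (continuous_const.mul (((cpd 0).pow 2).add ((cpd 1).pow 2)))).add
        (continuous_const.mul ((cpd 2).pow 2)))
  have cnb : Continuous (nBulkLower M G) := by
    unfold nBulkLower
    exact (continuous_sin.comp (PiLp.continuous_apply 2 _ 2)).mul
      (((((continuous_const.mul ((PiLp.continuous_apply 2 _ 1).sub continuous_const)).mul
        ((PiLp.continuous_apply 2 _ 1).add continuous_const)).mul ((cpd 1).pow 2)).add
        (continuous_const.mul ((cpd 0).pow 2))).add (continuous_const.mul ((cpd 2).pow 2)))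
  have c3sd := continuous_comp_boxPoint₃ csd φ₀
  have c3nb := continuous_comp_boxPoint₃ cnb φ₀
  -- the integrands as functions of `(θ, r)` at fixed `t`
  have mθr : Continuous fun p : ℝ × ℝ ↦ ((t, p.2, p.1) : ℝ × ℝ × ℝ) :=
    Continuous.prodMk continuous_const (Continuous.prodMk continuous_snd continuous_fst)
  have mr : ∀ θ : ℝ, Continuous fun r : ℝ ↦ ((t, r, θ) : ℝ × ℝ × ℝ) := fun θ ↦
    Continuous.prodMk continuous_const (Continuous.prodMk continuous_id continuous_const)
  -- the three densities of the statement, as continuous functions of `(θ, r)`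
  have cL : Continuous (Function.uncurry fun θ r ↦ sin θ * (G (boxPoint φ₀ t r θ) ^ 2 +
      (r - M) ^ 2 * pd 1 G (boxPoint φ₀ t r θ) ^ 2)) := by
    have h1 : Continuous fun p : ℝ × ℝ ↦ G (boxPoint φ₀ t p.2 p.1) := by
      have h := c3G.comp mθr; simp only [Function.comp_def] at h; exact h
    have h2 : Continuous fun p : ℝ × ℝ ↦ pd 1 G (boxPoint φ₀ t p.2 p.1) := by
      have h := (c3pd 1).comp mθr; simp only [Function.comp_def] at h; exact h
    exact (continuous_sin.comp continuous_fst).mul ((h1.pow 2).add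
      (((continuous_snd.sub continuous_const).pow 2).mul (h2.pow 2)))
  have cS : Continuous (Function.uncurry fun θ r ↦ slabDensity M G (boxPoint φ₀ t r θ)) := by
    have h := c3sd.comp mθr; simp only [Function.comp_def] at h; exact h
  have cK : Continuous (Function.uncurry fun θ r ↦ nBulkLower M G (boxPoint φ₀ t r θ)) := by
    have h := c3nb.comp mθr; simp only [Function.comp_def] at h; exact h
  -- linewise inequality
  have hline : ∀ θ ∈ Icc 0 π,
      (∫ r in M..(23 / 21 * M), sin θ * (G (boxPoint φ₀ t r θ) ^ 2 + (r - M) ^ 2 * pd 1 G (boxPoint φ₀ t r θ) ^ 2)) ≤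
      7 / M * (∫ r in (23 / 21 * M)..(8 / 7 * M), slabDensity M G (boxPoint φ₀ t r θ)) +
        5 * ∫ r in M..(23 / 21 * M), nBulkLower M G (boxPoint φ₀ t r θ) := by
    intro θ hθ
    have hs : 0 ≤ sin θ := sin_nonneg_of_nonneg_of_le_pi hθ.1 hθ.2
    -- the `r`-line functions
    have cg : Continuous fun r ↦ G (boxPoint φ₀ t r θ) := by
      have h := c3G.comp (mr θ); simp only [Function.comp_def] at h; exact h
    have cg' : Continuous fun r ↦ pd 1 G (boxPoint φ₀ t r θ) := by
      have h := (c3pd 1).comp (mr θ); simp only [Function.comp_def] at h; exact h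
    have csdl : Continuous fun r ↦ slabDensity M G (boxPoint φ₀ t r θ) := by
      have h := c3sd.comp (mr θ); simp only [Function.comp_def] at h; exact h
    have cnbl : Continuous fun r ↦ nBulkLower M G (boxPoint φ₀ t r θ) := by
      have h := c3nb.comp (mr θ); simp only [Function.comp_def] at h; exact h
    -- Poincaré on the line
    have hP := line_sq_slab_poincare hM (g := fun r ↦ G (boxPoint φ₀ t r θ))
      (g' := fun r ↦ pd 1 G (boxPoint φ₀ t r θ)) (fun r _ ↦ hasDerivAt_comp_boxPoint_r (hdiff _)) cg'.continuousOn
    -- slab terms by the slab density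
    have hs1 : ∫ r in (23 / 21 * M)..(8 / 7 * M), G (boxPoint φ₀ t r θ) ^ 2 * sin θ ≤
        ∫ r in (23 / 21 * M)..(8 / 7 * M), 1 / M * slabDensity M G (boxPoint φ₀ t r θ) := by
      refine intervalIntegral.integral_mono_on hNR ((cg.pow 2).mul continuous_const |>.intervalIntegrable _ _)
        ((continuous_const.mul csdl).intervalIntegrable _ _) fun r hr ↦ ?_
      simp only [slabDensity, boxPoint_apply_two]
      rw [div_mul_eq_mul_div, le_div_iff₀ hM]
      nlinarith [mul_nonneg hs (sq_nonneg (pd 0 G (boxPoint φ₀ t r θ))),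
        mul_nonneg hs (sq_nonneg (pd 1 G (boxPoint φ₀ t r θ))), mul_nonneg hs (sq_nonneg (pd 2 G (boxPoint φ₀ t r θ))),
        pow_nonneg hM.le 3]
    have hs2 : ∫ r in (23 / 21 * M)..(8 / 7 * M), (r - M) ^ 2 * pd 1 G (boxPoint φ₀ t r θ) ^ 2 * sin θ ≤
        ∫ r in (23 / 21 * M)..(8 / 7 * M), 1 / (49 * M) * slabDensity M G (boxPoint φ₀ t r θ) := by
      refine intervalIntegral.integral_mono_on hNR
        ((((continuous_id.sub continuous_const).pow 2).mul (cg'.pow 2)).mul continuous_const |>.intervalIntegrable _ _)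
        ((continuous_const.mul csdl).intervalIntegrable _ _) fun r hr ↦ ?_
      simp only [slabDensity, boxPoint_apply_two]
      rw [div_mul_eq_mul_div, le_div_iff₀ (by positivity)]
      have hw : (r - M) ^ 2 ≤ M ^ 2 / 49 := by
        have h1 : 0 ≤ r - M := by linarith [hr.1]
        have h2 : r - M ≤ M / 7 := by linarith [hr.2]
        nlinarith
      nlinarith [mul_nonneg hs (sq_nonneg (pd 0 G (boxPoint φ₀ t r θ))),
        mul_nonneg hs (sq_nonneg (pd 1 G (boxPoint φ₀ t r θ))), mul_nonneg hs (sq_nonneg (pd 2 G (boxPoint φ₀ t r θ))),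
        mul_nonneg hs (sq_nonneg (G (boxPoint φ₀ t r θ))),
        mul_le_mul_of_nonneg_right hw (mul_nonneg (sq_nonneg (pd 1 G (boxPoint φ₀ t r θ))) hs), pow_nonneg hM.le 3]
    -- the near-horizon weighted term by the coercive bulk
    have hs3 : ∫ r in M..(23 / 21 * M), (r - M) ^ 2 * pd 1 G (boxPoint φ₀ t r θ) ^ 2 * sin θ ≤
        ∫ r in M..(23 / 21 * M), nBulkLower M G (boxPoint φ₀ t r θ) := by
      refine intervalIntegral.integral_mono_on hMN
        ((((continuous_id.sub continuous_const).pow 2).mul (cg'.pow 2)).mul continuous_const |>.intervalIntegrable _ _)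
        (cnbl.intervalIntegrable _ _) fun r hr ↦ ?_
      simp only [nBulkLower, boxPoint_apply_one, boxPoint_apply_two]
      have hw : (r - M) ^ 2 ≤ 1 / 4 * (r - M) * (r + M) := by
        have h1 : 0 ≤ r - M := by linarith [hr.1]
        nlinarith [hr.2]
      nlinarith [mul_nonneg hs (sq_nonneg (pd 0 G (boxPoint φ₀ t r θ))),
        mul_nonneg hs (sq_nonneg (pd 2 G (boxPoint φ₀ t r θ))),
        mul_le_mul_of_nonneg_right hw (mul_nonneg (sq_nonneg (pd 1 G (boxPoint φ₀ t r θ))) hs)]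
    -- assemble the line inequality
    have iA : IntervalIntegrable (fun r ↦ sin θ * G (boxPoint φ₀ t r θ) ^ 2) volume M (23 / 21 * M) :=
      (continuous_const.mul (cg.pow 2)).intervalIntegrable _ _
    have iB : IntervalIntegrable (fun r ↦ (r - M) ^ 2 * pd 1 G (boxPoint φ₀ t r θ) ^ 2 * sin θ) volume M (23 / 21 * M) :=
      ((((continuous_id.sub continuous_const).pow 2).mul (cg'.pow 2)).mul continuous_const).intervalIntegrable _ _
    have e1 : (∫ r in M..(23 / 21 * M), sin θ * (G (boxPoint φ₀ t r θ) ^ 2 + (r - M) ^ 2 * pd 1 G (boxPoint φ₀ t r θ) ^ 2)) =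
        sin θ * (∫ r in M..(23 / 21 * M), G (boxPoint φ₀ t r θ) ^ 2) +
          sin θ * ∫ r in M..(23 / 21 * M), (r - M) ^ 2 * pd 1 G (boxPoint φ₀ t r θ) ^ 2 := by
      rw [← intervalIntegral.integral_const_mul, ← intervalIntegral.integral_const_mul,
        ← intervalIntegral.integral_add iA]
      · refine intervalIntegral.integral_congr fun r _ ↦ ?_
        ring
      · exact (continuous_const.mul (((continuous_id.sub continuous_const).pow 2).mul (cg'.pow 2))).intervalIntegrable _ _
    have e2 : (∫ r in (23 / 21 * M)..(8 / 7 * M), G (boxPoint φ₀ t r θ) ^ 2 * sin θ) =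
        sin θ * ∫ r in (23 / 21 * M)..(8 / 7 * M), G (boxPoint φ₀ t r θ) ^ 2 := by
      rw [← intervalIntegral.integral_const_mul]
      refine intervalIntegral.integral_congr fun r _ ↦ ?_
      ring
    have e3 : (∫ r in (23 / 21 * M)..(8 / 7 * M), (r - M) ^ 2 * pd 1 G (boxPoint φ₀ t r θ) ^ 2 * sin θ) =
        sin θ * ∫ r in (23 / 21 * M)..(8 / 7 * M), (r - M) ^ 2 * pd 1 G (boxPoint φ₀ t r θ) ^ 2 := by
      rw [← intervalIntegral.integral_const_mul]
      refine intervalIntegral.integral_congr fun r _ ↦ ?_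
      ring
    have e4 : (∫ r in M..(23 / 21 * M), (r - M) ^ 2 * pd 1 G (boxPoint φ₀ t r θ) ^ 2 * sin θ) =
        sin θ * ∫ r in M..(23 / 21 * M), (r - M) ^ 2 * pd 1 G (boxPoint φ₀ t r θ) ^ 2 := by
      rw [← intervalIntegral.integral_const_mul]
      refine intervalIntegral.integral_congr fun r _ ↦ ?_
      ring
    rw [intervalIntegral.integral_const_mul] at hs1 hs2
    have hsd0 : 0 ≤ ∫ r in (23 / 21 * M)..(8 / 7 * M), slabDensity M G (boxPoint φ₀ t r θ) :=
      intervalIntegral.integral_nonneg hNR fun r _ ↦ slabDensity_nonneg hM.le G (q := boxPoint φ₀ t r θ) (by simpa using hθ)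
    have hP' := mul_le_mul_of_nonneg_left hP hs
    have hP'' : sin θ * (∫ r in M..(23 / 21 * M), G (boxPoint φ₀ t r θ) ^ 2) ≤
        6 * (sin θ * ∫ r in (23 / 21 * M)..(8 / 7 * M), G (boxPoint φ₀ t r θ) ^ 2) +
        4 * (sin θ * ∫ r in M..(23 / 21 * M), (r - M) ^ 2 * pd 1 G (boxPoint φ₀ t r θ) ^ 2) +
        4 * (sin θ * ∫ r in (23 / 21 * M)..(8 / 7 * M), (r - M) ^ 2 * pd 1 G (boxPoint φ₀ t r θ) ^ 2) := by
      have h := hP'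
      ring_nf at h ⊢
      linarith
    rw [e1]
    rw [e2] at hs1
    rw [e3] at hs2
    rw [e4] at hs3
    have h49 : 1 / (49 * M) * (∫ r in (23 / 21 * M)..(8 / 7 * M), slabDensity M G (boxPoint φ₀ t r θ)) =
        1 / 49 * (1 / M * ∫ r in (23 / 21 * M)..(8 / 7 * M), slabDensity M G (boxPoint φ₀ t r θ)) := by ring
    rw [h49] at hs2
    have hkey : 7 / M * (∫ r in (23 / 21 * M)..(8 / 7 * M), slabDensity M G (boxPoint φ₀ t r θ)) =
        7 * (1 / M * ∫ r in (23 / 21 * M)..(8 / 7 * M), slabDensity M G (boxPoint φ₀ t r θ)) := by ring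
    rw [hkey]
    have hsd0' : 0 ≤ 1 / M * ∫ r in (23 / 21 * M)..(8 / 7 * M), slabDensity M G (boxPoint φ₀ t r θ) := by positivity
    linarith
  -- integrate over `θ`
  have iL : IntervalIntegrable (fun θ ↦ ∫ r in M..(23 / 21 * M), sin θ * (G (boxPoint φ₀ t r θ) ^ 2 +
      (r - M) ^ 2 * pd 1 G (boxPoint φ₀ t r θ) ^ 2)) volume 0 π :=
    (intervalIntegral.continuous_parametric_intervalIntegral_of_continuous' cL M (23 / 21 * M)).intervalIntegrable 0 π
  have iS : IntervalIntegrable (fun θ ↦ ∫ r in (23 / 21 * M)..(8 / 7 * M), slabDensity M G (boxPoint φ₀ t r θ)) volume 0 π :=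
    (intervalIntegral.continuous_parametric_intervalIntegral_of_continuous' cS (23 / 21 * M) (8 / 7 * M)).intervalIntegrable 0 π
  have iK : IntervalIntegrable (fun θ ↦ ∫ r in M..(23 / 21 * M), nBulkLower M G (boxPoint φ₀ t r θ)) volume 0 π :=
    (intervalIntegral.continuous_parametric_intervalIntegral_of_continuous' cK M (23 / 21 * M)).intervalIntegrable 0 π
  have hmono := intervalIntegral.integral_mono_on hπ iL ((iS.const_mul (7 / M)).add (iK.const_mul 5)) hline
  rw [intervalIntegral.integral_add (iS.const_mul _) (iK.const_mul _), intervalIntegral.integral_const_mul,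
    intervalIntegral.integral_const_mul] at hmono
  exact hmono

end Zeroth

/-! ### Global continuity of box slices and near-horizon Hardy (coordinates, `G` globally smooth) -/

section GlobalCoord

variable {M : ℝ} {G : E4 → ℝ}

/-- Continuity of `(t, θ) ↦ ∫_a^b F(p(φ₀; t, r, θ)) dr` for `F` continuous. [folklore] -/
theorem continuous_boxLine₂ {F : E4 → ℝ} (hF : Continuous F) (φ₀ a b : ℝ) :
    Continuous fun p : ℝ × ℝ ↦ ∫ r in a..b, F (boxPoint φ₀ p.1 r p.2) := by
  have m : Continuous fun q : (ℝ × ℝ) × ℝ ↦ ((q.1.1, q.2, q.1.2) : ℝ × ℝ × ℝ) :=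
    Continuous.prodMk (continuous_fst.comp continuous_fst) (Continuous.prodMk continuous_snd
      (continuous_snd.comp continuous_fst))
  have h : Continuous (Function.uncurry fun (p : ℝ × ℝ) r ↦ F (boxPoint φ₀ p.1 r p.2)) := by
    have h := (continuous_comp_boxPoint₃ hF φ₀).comp m
    simp only [Function.comp_def] at h
    exact h
  exact intervalIntegral.continuous_parametric_intervalIntegral_of_continuous' h a b

/-- Continuity of the slice `t ↦ ∫₀^π∫_a^b F(p(φ₀; t, r, θ))` for `F` continuous. [folklore] -/
theorem continuous_boxSlice {F : E4 → ℝ} (hF : Continuous F) (φ₀ a b : ℝ) :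
    Continuous fun t ↦ ∫ θ in (0 : ℝ)..π, ∫ r in a..b, F (boxPoint φ₀ t r θ) := by
  have h : Continuous (Function.uncurry fun t θ ↦ ∫ r in a..b, F (boxPoint φ₀ t r θ)) :=
    continuous_boxLine₂ hF φ₀ a b
  exact intervalIntegral.continuous_parametric_intervalIntegral_of_continuous' h 0 π

/-- The densities of the method are continuous for `G ∈ C^∞(E4)`. [folklore] -/
theorem continuous_densities (hG : ContDiff ℝ ∞ G) (M : ℝ) :
    Continuous (tEnergy M M G) ∧ Continuous (slabDensity M G) ∧ Continuous (nBulkLower M G) ∧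
      Continuous (nEnergyLower M G) ∧ Continuous (fun q ↦ sin (q 2) * G q ^ 2) ∧
      Continuous (fun q ↦ sin (q 2) * (G q ^ 2 + pd 1 G q ^ 2)) ∧
      Continuous (fun q ↦ sin (q 2) * (G q ^ 2 + (q 1 - M) ^ 2 * pd 1 G q ^ 2)) := by
  have cG : Continuous G := hG.continuous
  have cpd : ∀ i, Continuous (pd i G) := fun i ↦
    (hG.continuous_fderiv (by simp)).clm_apply continuous_const
  have c1 : Continuous fun q : E4 ↦ q 1 := PiLp.continuous_apply 2 _ 1
  have cs : Continuous fun q : E4 ↦ sin (q 2) := continuous_sin.comp (PiLp.continuous_apply 2 _ 2)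
  have cc : Continuous fun q : E4 ↦ cos (q 2) := continuous_cos.comp (PiLp.continuous_apply 2 _ 2)
  have cSig : Continuous fun q : E4 ↦ q 1 ^ 2 + M ^ 2 * cos (q 2) ^ 2 + 2 * M * q 1 :=
    ((c1.pow 2).add (continuous_const.mul (cc.pow 2))).add (continuous_const.mul c1)
  have ch : Continuous fun q : E4 ↦ 20 * q 1 - 37 / 2 * M := (continuous_const.mul c1).sub continuous_const
  refine ⟨?_, ?_, ?_, ?_, ?_, ?_, ?_⟩
  · unfold tEnergy
    exact (continuous_const.mul cs).mul ((((((c1.pow 2).sub (continuous_const.mul c1)).add continuous_const).mul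
      ((cpd 1).pow 2)).add (cSig.mul ((cpd 0).pow 2))).add ((cpd 2).pow 2))
  · unfold slabDensity
    exact cs.mul (((continuous_const.mul (cG.pow 2)).add (continuous_const.mul (((cpd 0).pow 2).add
      ((cpd 1).pow 2)))).add (continuous_const.mul ((cpd 2).pow 2)))
  · unfold nBulkLower
    exact cs.mul (((((continuous_const.mul (c1.sub continuous_const)).mul (c1.add continuous_const)).mul
      ((cpd 1).pow 2)).add (continuous_const.mul ((cpd 0).pow 2))).add (continuous_const.mul ((cpd 2).pow 2)))
  · unfold nEnergyLower
    exact cs.mul (((continuous_const.mul ((cpd 1).pow 2)).add (((ch.mul cSig).div_const 16).mul ((cpd 0).pow 2))).add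
      ((continuous_const.mul ch).mul ((cpd 2).pow 2)))
  · exact cs.mul (cG.pow 2)
  · exact cs.mul ((cG.pow 2).add ((cpd 1).pow 2))
  · exact cs.mul ((cG.pow 2).add (((c1.sub continuous_const).pow 2).mul ((cpd 1).pow 2)))

/-- **Zeroth-order slice near the horizon by the `T`-energy (global form of the Hardy step):** for
`G ∈ C^∞(E4)`, `M ≤ r' ≤ R`, and `G(p(φ₀; t, R, θ)) = 0` for `θ ∈ [0, π]`,
`∫₀^π∫_M^{r'} sin θ G² ≤ 8 ∫₀^π∫_M^R e_T`. [cite: Aretakis2012, §13.1] -/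
theorem nearSq_le_tEnergy (hM : 0 < M) (hG : ContDiff ℝ ∞ G) {t R r' φ₀ : ℝ} (hMr' : M ≤ r') (hr'R : r' ≤ R)
    (hfar0 : ∀ θ ∈ Icc 0 π, G (boxPoint φ₀ t R θ) = 0) :
    (∫ θ in (0 : ℝ)..π, ∫ r in M..r', sin ((boxPoint φ₀ t r θ) 2) * G (boxPoint φ₀ t r θ) ^ 2) ≤
      8 * ∫ θ in (0 : ℝ)..π, ∫ r in M..R, tEnergy M M G (boxPoint φ₀ t r θ) := by
  have hMR : M ≤ R := hMr'.trans hr'R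
  obtain ⟨cT, -, -, -, cG2, -, -⟩ := continuous_densities hG M
  have cpd1 : Continuous (pd 1 G) := (hG.continuous_fderiv (by simp)).clm_apply continuous_const
  have c1 : Continuous fun q : E4 ↦ q 1 := PiLp.continuous_apply 2 _ 1
  have cs : Continuous fun q : E4 ↦ sin (q 2) := continuous_sin.comp (PiLp.continuous_apply 2 _ 2)
  have cH : Continuous fun q ↦ 4 * (sin (q 2) * ((q 1 - M) ^ 2 * pd 1 G q ^ 2)) :=
    continuous_const.mul (cs.mul (((c1.sub continuous_const).pow 2).mul (cpd1.pow 2)))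
  have hU : ∀ {a b : ℝ}, ∀ r ∈ Icc a b, ∀ θ ∈ Icc (0 : ℝ) π, boxPoint φ₀ t r θ ∈ (univ : Set E4) :=
    fun _ _ _ _ ↦ mem_univ _
  -- enlarge
  have h2' : (∫ θ in (0 : ℝ)..π, ∫ r in M..r', sin ((boxPoint φ₀ t r θ) 2) * G (boxPoint φ₀ t r θ) ^ 2) ≤
      ∫ θ in (0 : ℝ)..π, ∫ r in M..R, sin ((boxPoint φ₀ t r θ) 2) * G (boxPoint φ₀ t r θ) ^ 2 := by
    refine theta_integral_mono_of_line (W₀ := univ) (F := fun q ↦ sin (q 2) * G q ^ 2) (G := fun q ↦ sin (q 2) * G q ^ 2)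
      cG2.continuousOn cG2.continuousOn hMr' hMR hU hU fun θ hθ ↦ ?_
    have hco : Continuous fun r ↦ sin ((boxPoint φ₀ t r θ) 2) * G (boxPoint φ₀ t r θ) ^ 2 := by
      have h := (continuous_comp_boxPoint₃ cG2 φ₀).comp (Continuous.prodMk continuous_const
        (Continuous.prodMk continuous_id continuous_const) : Continuous fun r : ℝ ↦ ((t, r, θ) : ℝ × ℝ × ℝ))
      simp only [Function.comp_def] at h
      exact h
    refine intervalIntegral.integral_mono_interval le_rfl hMr' hr'R ?_ (hco.intervalIntegrable _ _)
    refine MeasureTheory.ae_of_all _ fun r ↦ ?_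
    simp only [boxPoint_apply_two]
    exact mul_nonneg (sin_nonneg_of_nonneg_of_le_pi hθ.1 hθ.2) (sq_nonneg _)
  -- Hardy
  have h3' : (∫ θ in (0 : ℝ)..π, ∫ r in M..R, sin ((boxPoint φ₀ t r θ) 2) * G (boxPoint φ₀ t r θ) ^ 2) ≤
      ∫ θ in (0 : ℝ)..π, ∫ r in M..R, 4 * (sin ((boxPoint φ₀ t r θ) 2) *
        (((boxPoint φ₀ t r θ) 1 - M) ^ 2 * pd 1 G (boxPoint φ₀ t r θ) ^ 2)) := by
    refine theta_integral_mono_of_line (W₀ := univ) (F := fun q ↦ sin (q 2) * G q ^ 2)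
      (G := fun q ↦ 4 * (sin (q 2) * ((q 1 - M) ^ 2 * pd 1 G q ^ 2)))
      cG2.continuousOn cH.continuousOn hMR hMR hU hU fun θ hθ ↦ ?_
    simp only [boxPoint_apply_two, boxPoint_apply_one]
    rw [intervalIntegral.integral_const_mul, intervalIntegral.integral_const_mul,
      intervalIntegral.integral_const_mul]
    have hH := line_sq_le_hardy (W₀ := univ) isOpen_univ hG.contDiffOn hMR (fun r hr ↦ mem_univ _) (hfar0 θ hθ)
      (φ₀ := φ₀) (t := t)
    have hs : 0 ≤ sin θ := sin_nonneg_of_nonneg_of_le_pi hθ.1 hθ.2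
    nlinarith [mul_le_mul_of_nonneg_left hH hs]
  -- `T`-energy domination
  have h4' : (∫ θ in (0 : ℝ)..π, ∫ r in M..R, 4 * (sin ((boxPoint φ₀ t r θ) 2) *
        (((boxPoint φ₀ t r θ) 1 - M) ^ 2 * pd 1 G (boxPoint φ₀ t r θ) ^ 2))) ≤
      ∫ θ in (0 : ℝ)..π, ∫ r in M..R, 8 * tEnergy M M G (boxPoint φ₀ t r θ) := by
    refine box2_integral_mono (W₀ := univ) (F := fun q ↦ 4 * (sin (q 2) * ((q 1 - M) ^ 2 * pd 1 G q ^ 2)))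
      (G := fun q ↦ 8 * tEnergy M M G q) cH.continuousOn (continuous_const.mul cT).continuousOn hMR
      hU fun r hr θ hθ ↦ ?_
    have hs : 0 ≤ sin θ := sin_nonneg_of_nonneg_of_le_pi hθ.1 hθ.2
    have hrM : M ≤ r := hr.1
    simp only [tEnergy, boxPoint_apply_one, boxPoint_apply_two]
    have hS : (0 : ℝ) ≤ (r ^ 2 + M ^ 2 * cos θ ^ 2 + 2 * M * r) * pd 0 G (boxPoint φ₀ t r θ) ^ 2 := by
      have : (0 : ℝ) ≤ r ^ 2 + M ^ 2 * cos θ ^ 2 + 2 * M * r := by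
        have hr0 : 0 ≤ r := hM.le.trans hrM
        positivity
      positivity
    nlinarith [mul_nonneg hs hS, mul_nonneg hs (sq_nonneg (pd 2 G (boxPoint φ₀ t r θ)))]
  have h4s : (∫ θ in (0 : ℝ)..π, ∫ r in M..R, 8 * tEnergy M M G (boxPoint φ₀ t r θ)) =
      8 * ∫ θ in (0 : ℝ)..π, ∫ r in M..R, tEnergy M M G (boxPoint φ₀ t r θ) := by
    simp only [intervalIntegral.integral_const_mul]
  linarith

end GlobalCoord

/-- Non-negativity of the coercive densities on `𝓐_N` (for `θ ∈ [0, π]`, `M > 0`). [folklore] -/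
theorem nEnergyLower_nonneg_of {M : ℝ} (hM : 0 < M) (G : E4 → ℝ) {q : E4} (hr : M ≤ q 1) (hθ : q 2 ∈ Icc 0 π) :
    0 ≤ nEnergyLower M G q ∧ 0 ≤ nBulkLower M G q := by
  have hs : 0 ≤ sin (q 2) := sin_nonneg_of_nonneg_of_le_pi hθ.1 hθ.2
  have hh : 0 ≤ 20 * q 1 - 37 / 2 * M := by linarith
  have hq0 : 0 ≤ q 1 := hM.le.trans hr
  have hS : 0 ≤ q 1 ^ 2 + M ^ 2 * cos (q 2) ^ 2 + 2 * M * q 1 := by positivity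
  have hw : 0 ≤ 1 / 4 * (q 1 - M) * (q 1 + M) := by
    have h1 : 0 ≤ q 1 - M := by linarith
    positivity
  simp only [nEnergyLower, nBulkLower]
  constructor <;> positivity

/-! ### The class: consequences of the slab bound -/

section Class

variable [Kerr.Facts] [Kerr.SliceFacts] {M r₀ : ℝ} {U₀ : Set (Kerr.region M r₀)} {Φ : E4 → ℝ}

/-- **The data `T`-energy does not see beyond the support**: for the class with data supported in
`|x| ≤ ρ` on `{t* = 0}`, `∫₀^π∫_M^R e_T(0) = ∫₀^π∫_M^{ρ''} e_T(0)` for all `R ≥ ρ'' = max(ρ, 2M) + 2`.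
[cite: Aretakis2012, §4.2] -/
theorem tEnergy_data_far_eq (hM : 0 < M) (hr₀ : r₀ ∈ Set.Ioo 0 M) (hU₀ : IsOpen U₀)
    (hKU : {x : Kerr.region M r₀ | Kerr.rPlus M M ≤ Kerr.radius M (x : E4) ∧ 0 ≤ (x : E4) 0} ⊆ U₀)
    (hΦ : ContDiff ℝ ∞ Φ)
    (hsol : ∀ x ∈ U₀, (Kerr.smoothMetric M M r₀).toPseudoRiemannianMetric.dalembertian
      (fun y : Kerr.region M r₀ ↦ Φ y) x = 0)
    {ρ : ℝ} (hloc : ∀ x ∈ U₀, (x : E4) 0 = 0 → ρ < E4.spatialNorm (x : E4) → Φ x = 0 ∧ fderiv ℝ Φ x = 0)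
    {R φ₀ : ℝ} (hR : max ρ (2 * M) + 2 ≤ R) :
    (∫ θ in (0 : ℝ)..π, ∫ r in M..R, tEnergy M M (Kerr.starPull M Φ) (boxPoint φ₀ 0 r θ)) =
      ∫ θ in (0 : ℝ)..π, ∫ r in M..(max ρ (2 * M) + 2), tEnergy M M (Kerr.starPull M Φ) (boxPoint φ₀ 0 r θ) := by
  have hG : ContDiff ℝ ∞ (Kerr.starPull M Φ) := hΦ.comp (Kerr.contDiff_starChart M)
  obtain ⟨cT, -⟩ := continuous_densities hG M
  have hMρ : M ≤ max ρ (2 * M) + 2 := by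
    have : 2 * M ≤ max ρ (2 * M) := le_max_right _ _
    linarith
  refine intervalIntegral.integral_congr fun θ _ ↦ ?_
  have hco : Continuous fun r ↦ tEnergy M M (Kerr.starPull M Φ) (boxPoint φ₀ 0 r θ) := by
    have h := (continuous_comp_boxPoint₃ cT φ₀).comp (Continuous.prodMk continuous_const
      (Continuous.prodMk continuous_id continuous_const) : Continuous fun r : ℝ ↦ (((0 : ℝ), r, θ) : ℝ × ℝ × ℝ))
    simp only [Function.comp_def] at h
    exact h
  rw [← intervalIntegral.integral_add_adjacent_intervals (hco.intervalIntegrable M (max ρ (2 * M) + 2))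
    (hco.intervalIntegrable (max ρ (2 * M) + 2) R)]
  have hzero : ∫ r in (max ρ (2 * M) + 2)..R, tEnergy M M (Kerr.starPull M Φ) (boxPoint φ₀ 0 r θ) = 0 := by
    refine intervalIntegral.integral_zero_ae (MeasureTheory.ae_of_all _ fun r hr ↦ ?_)
    rw [uIoc_of_le hR] at hr
    have hfar : max ρ (2 * M) + 1 + 0 < r := by linarith [hr.1]
    obtain ⟨-, hdΦ⟩ := fderiv_shellPoint_eq_zero_of_far hM hr₀ hU₀ hKU (fun x _ ↦ hΦ.contDiffAt) hsol hloc hfar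
      le_rfl le_rfl θ φ₀
    have hd : DifferentiableAt ℝ Φ (shellPoint M 0 r θ φ₀) := (hΦ.differentiable (by simp)) _
    have hpd : ∀ i, pd i (Kerr.starPull M Φ) (boxPoint φ₀ 0 r θ) = 0 := fun i ↦ by
      rw [pd_starPull_boxPoint hd, hdΦ]; rfl
    simp only [tEnergy, hpd]
    ring
  rw [hzero, add_zero]

/-- **Consequences of a slab bound for the class (at azimuth `0`).** For `Φ ∈ C^∞(E4)` axisymmetric,
solving the wave equation on an open `U₀ ⊇ {r ≥ M, t* ≥ 0}` of the extremal Kerr region, with data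
supported in `|x| ≤ ρ` on `{t* = 0}`, and a bound `I` for the transition-slab spacetime integrals
`∫_0^τ∫∫_{slab} slabDensity` (`τ ≥ 0`): there is `B ≥ 0` with, for all `τ ≥ 0`,
`½ ∫∫_{𝓐_N} e_low(τ) + ∫_0^τ∫∫_{𝓐_N} K_low ≤ B` and `∫∫_{𝓐_N} sin θ G(τ)² ≤ B`.
[cite: Aretakis2012, §13.1 and Thm. 1–2] -/
theorem horizon_bounds_of_class (hM : 0 < M) (hr₀ : r₀ ∈ Set.Ioo 0 M) (hU₀ : IsOpen U₀)
    (hKU : {x : Kerr.region M r₀ | Kerr.rPlus M M ≤ Kerr.radius M (x : E4) ∧ 0 ≤ (x : E4) 0} ⊆ U₀)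
    (hΦ : ContDiff ℝ ∞ Φ) (haxi : ∀ (β : ℝ) (z : E4), Φ (E4.axialRotation β z) = Φ z)
    (hsol : ∀ x ∈ U₀, (Kerr.smoothMetric M M r₀).toPseudoRiemannianMetric.dalembertian
      (fun y : Kerr.region M r₀ ↦ Φ y) x = 0)
    {ρ : ℝ} (hloc : ∀ x ∈ U₀, (x : E4) 0 = 0 → ρ < E4.spatialNorm (x : E4) → Φ x = 0 ∧ fderiv ℝ Φ x = 0)
    {I : ℝ} (hI : ∀ τ : ℝ, 0 ≤ τ → (∫ t in (0 : ℝ)..τ, ∫ θ in (0 : ℝ)..π, ∫ r in (23 / 21 * M)..(8 / 7 * M),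
      slabDensity M (Kerr.starPull M Φ) (boxPoint 0 t r θ)) ≤ I) :
    ∃ B : ℝ, 0 ≤ B ∧ ∀ τ : ℝ, 0 ≤ τ →
      1 / 2 * (∫ θ in (0 : ℝ)..π, ∫ r in M..(23 / 21 * M), nEnergyLower M (Kerr.starPull M Φ) (boxPoint 0 τ r θ)) +
          (∫ t in (0 : ℝ)..τ, ∫ θ in (0 : ℝ)..π, ∫ r in M..(23 / 21 * M),
            nBulkLower M (Kerr.starPull M Φ) (boxPoint 0 t r θ)) ≤ B ∧
      (∫ θ in (0 : ℝ)..π, ∫ r in M..(23 / 21 * M), sin ((boxPoint 0 τ r θ) 2) *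
          Kerr.starPull M Φ (boxPoint 0 τ r θ) ^ 2) ≤ B := by
  obtain ⟨hr₀pos, hr₀M⟩ := hr₀
  have hG : ContDiff ℝ ∞ (Kerr.starPull M Φ) := hΦ.comp (Kerr.contDiff_starChart M)
  have hΦ' : ∀ x ∈ U₀, ContDiffAt ℝ ∞ Φ x := fun x _ ↦ hΦ.contDiffAt
  have haxi' : ∀ (β : ℝ) (z : E4), 0 < Kerr.radius M z → Φ (E4.axialRotation β z) = Φ z := fun β z _ ↦ haxi β z
  have hMN : M ≤ 23 / 21 * M := by linarith
  have hρ : 2 * M ≤ max ρ (2 * M) := le_max_right _ _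
  -- the constants
  obtain ⟨Es, hEs⟩ : ∃ Es : ℝ, Es = ∫ θ in (0 : ℝ)..π, ∫ r in M..(max ρ (2 * M) + 2),
      tEnergy M M (Kerr.starPull M Φ) (boxPoint 0 0 r θ) := ⟨_, rfl⟩
  obtain ⟨En, hEn⟩ : ∃ En : ℝ, En = ∫ θ in (0 : ℝ)..π, ∫ r in M..(23 / 21 * M),
      -multDensity M M (nProfileR M) (nProfileT M) nProfileW (Kerr.starPull M Φ) (boxPoint 0 0 r θ) := ⟨_, rfl⟩
  refine ⟨max 0 (max (En + 55176 * M * Es + 2620 / M * I) (8 * Es)), le_max_left _ _, fun τ hτ ↦ ?_⟩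
  -- the outer radius for this `τ`
  have hr₂ : max ρ (2 * M) + 1 + τ < max ρ (2 * M) + 2 + τ := by linarith
  have hMr₂ : M ≤ max ρ (2 * M) + 2 + τ := by linarith
  have hNr₂ : 23 / 21 * M ≤ max ρ (2 * M) + 2 + τ := by linarith
  have hρ₂ : max ρ (2 * M) + 2 ≤ max ρ (2 * M) + 2 + τ := by linarith
  -- far field on the outer cylinder
  have hfar : ∀ t ∈ Icc 0 τ, ∀ θ : ℝ, Φ (shellPoint M t (max ρ (2 * M) + 2 + τ) θ 0) = 0 ∧
      fderiv ℝ Φ (shellPoint M t (max ρ (2 * M) + 2 + τ) θ 0) = 0 := fun t ht θ ↦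
    fderiv_shellPoint_eq_zero_of_far hM ⟨hr₀pos, hr₀M⟩ hU₀ hKU hΦ' hsol hloc hr₂ ht.1 ht.2 θ 0
  -- (R) the slab bound
  have hR := nEnergy_slab_bound_of_class hM ⟨hr₀pos, hr₀M⟩ hU₀ hKU hΦ' haxi' hsol hloc (φ₀ := 0)
    (t₁ := 0) (t₂ := τ) (T := τ) le_rfl hτ le_rfl hr₂
  have hE := tEnergy_data_far_eq hM ⟨hr₀pos, hr₀M⟩ hU₀ hKU hΦ hsol hloc (φ₀ := 0) hρ₂
  rw [hE, ← hEs, ← hEn] at hR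
  have hST := mul_le_mul_of_nonneg_left (hI τ hτ) (by positivity : (0 : ℝ) ≤ 2620 / M)
  constructor
  · calc _ ≤ En + 55176 * M * Es + 2620 / M * I := by linarith
      _ ≤ _ := (le_max_left _ _).trans (le_max_right _ _)
  · -- zeroth order at `τ` by the `T`-energy at `τ`, then at `0`
    have h1 := nearSq_le_tEnergy hM hG (t := τ) (φ₀ := 0) hMN hNr₂
      (fun θ _ ↦ by rw [starPull_boxPoint_eq]; exact (hfar τ ⟨hτ, le_rfl⟩ θ).1)
    have h2 := (degTEnergy_antitone_and_horizonFlux_le hM ⟨hr₀pos, hr₀M⟩ hU₀ hKU hΦ' haxi' hsol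
      (t₁ := 0) (t₂ := τ) (r₂ := max ρ (2 * M) + 2 + τ) (φ₀ := 0) le_rfl hτ hMr₂
      (fun t ht θ _ ↦ (hfar t ht θ).2)).1
    have hconv : ∀ t : ℝ, (∫ θ in (0 : ℝ)..π, ∫ r in M..(max ρ (2 * M) + 2 + τ),
        tEnergy M M (Kerr.starPull M Φ) (boxPoint 0 t r θ)) =
        ∫ θ in (0 : ℝ)..π, ∫ r in M..(max ρ (2 * M) + 2 + τ), degTEnergyDensity M Φ t r θ 0 := by
      intro t
      refine intervalIntegral.integral_congr fun θ _ ↦ intervalIntegral.integral_congr fun r _ ↦ ?_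
      exact tEnergy_starPull_boxPoint ((hΦ.differentiable (by simp)) _)
    rw [← hconv τ, ← hconv 0, hE, ← hEs] at h2
    calc _ ≤ 8 * Es := by linarith
      _ ≤ _ := (le_max_right _ _).trans (le_max_right _ _)

/-- **Integrability in time of the coercive bulk slice and of the slab slice** (class, azimuth `0`):
both `t ↦ ∫∫_{𝓐_N} K_low(t)` and `t ↦ ∫∫_{slab} slabDensity(t)` are integrable on `(0, ∞)`, their
primitives being bounded (`horizon_bounds_of_class` and the slab hypothesis).
[cite: Aretakis2012, §13.1 and Thm. 1–2] -/
theorem integrable_slices_of_class (hM : 0 < M) (hr₀ : r₀ ∈ Set.Ioo 0 M) (hU₀ : IsOpen U₀)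
    (hKU : {x : Kerr.region M r₀ | Kerr.rPlus M M ≤ Kerr.radius M (x : E4) ∧ 0 ≤ (x : E4) 0} ⊆ U₀)
    (hΦ : ContDiff ℝ ∞ Φ) (haxi : ∀ (β : ℝ) (z : E4), Φ (E4.axialRotation β z) = Φ z)
    (hsol : ∀ x ∈ U₀, (Kerr.smoothMetric M M r₀).toPseudoRiemannianMetric.dalembertian
      (fun y : Kerr.region M r₀ ↦ Φ y) x = 0)
    {ρ : ℝ} (hloc : ∀ x ∈ U₀, (x : E4) 0 = 0 → ρ < E4.spatialNorm (x : E4) → Φ x = 0 ∧ fderiv ℝ Φ x = 0)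
    {I : ℝ} (hI : ∀ τ : ℝ, 0 ≤ τ → (∫ t in (0 : ℝ)..τ, ∫ θ in (0 : ℝ)..π, ∫ r in (23 / 21 * M)..(8 / 7 * M),
      slabDensity M (Kerr.starPull M Φ) (boxPoint 0 t r θ)) ≤ I) :
    IntegrableOn (fun t ↦ ∫ θ in (0 : ℝ)..π, ∫ r in M..(23 / 21 * M),
        nBulkLower M (Kerr.starPull M Φ) (boxPoint 0 t r θ)) (Ioi 0) ∧
      IntegrableOn (fun t ↦ ∫ θ in (0 : ℝ)..π, ∫ r in (23 / 21 * M)..(8 / 7 * M),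
        slabDensity M (Kerr.starPull M Φ) (boxPoint 0 t r θ)) (Ioi 0) := by
  have hπ : (0 : ℝ) ≤ π := pi_pos.le
  have hMN : M ≤ 23 / 21 * M := by linarith
  have hNR : 23 / 21 * M ≤ 8 / 7 * M := by linarith
  have hG : ContDiff ℝ ∞ (Kerr.starPull M Φ) := hΦ.comp (Kerr.contDiff_starChart M)
  obtain ⟨-, cS, cK, cL, -⟩ := continuous_densities hG M
  obtain ⟨B, hB0, hB⟩ := horizon_bounds_of_class hM hr₀ hU₀ hKU hΦ haxi hsol hloc hI
  have cKs := continuous_boxSlice cK 0 M (23 / 21 * M)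
  have cSs := continuous_boxSlice cS 0 (23 / 21 * M) (8 / 7 * M)
  -- nonnegativity of the slices
  have hK0 : ∀ t, 0 ≤ ∫ θ in (0 : ℝ)..π, ∫ r in M..(23 / 21 * M), nBulkLower M (Kerr.starPull M Φ) (boxPoint 0 t r θ) :=
    fun t ↦ intervalIntegral.integral_nonneg hπ fun θ hθ ↦ intervalIntegral.integral_nonneg hMN fun r hr ↦
      (nEnergyLower_nonneg_of hM _ (q := boxPoint 0 t r θ) (by simpa using hr.1) (by simpa using hθ)).2
  have hL0 : ∀ t, 0 ≤ ∫ θ in (0 : ℝ)..π, ∫ r in M..(23 / 21 * M), nEnergyLower M (Kerr.starPull M Φ) (boxPoint 0 t r θ) :=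
    fun t ↦ intervalIntegral.integral_nonneg hπ fun θ hθ ↦ intervalIntegral.integral_nonneg hMN fun r hr ↦
      (nEnergyLower_nonneg_of hM _ (q := boxPoint 0 t r θ) (by simpa using hr.1) (by simpa using hθ)).1
  have hS0 : ∀ t, 0 ≤ ∫ θ in (0 : ℝ)..π, ∫ r in (23 / 21 * M)..(8 / 7 * M), slabDensity M (Kerr.starPull M Φ) (boxPoint 0 t r θ) :=
    fun t ↦ intervalIntegral.integral_nonneg hπ fun θ hθ ↦ intervalIntegral.integral_nonneg hNR fun r _ ↦
      slabDensity_nonneg hM.le _ (q := boxPoint 0 t r θ) (by simpa using hθ)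
  constructor
  · refine integrableOn_Ioi_of_intervalIntegral_norm_bounded (l := atTop) (b := fun n : ℕ ↦ (n : ℝ)) B 0
      (fun n ↦ (cKs.integrableOn_Icc).mono_set Ioc_subset_Icc_self) tendsto_natCast_atTop_atTop
      (Eventually.of_forall fun n ↦ ?_)
    have hn : (0 : ℝ) ≤ n := n.cast_nonneg
    have h := (hB n hn).1
    have hnorm : (∫ x in (0 : ℝ)..n, ‖∫ θ in (0 : ℝ)..π, ∫ r in M..(23 / 21 * M),
        nBulkLower M (Kerr.starPull M Φ) (boxPoint 0 x r θ)‖) =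
        ∫ x in (0 : ℝ)..n, ∫ θ in (0 : ℝ)..π, ∫ r in M..(23 / 21 * M), nBulkLower M (Kerr.starPull M Φ) (boxPoint 0 x r θ) :=
      intervalIntegral.integral_congr fun x _ ↦ by rw [Real.norm_eq_abs, abs_of_nonneg (hK0 x)]
    rw [hnorm]
    linarith [hL0 (n : ℝ)]
  · refine integrableOn_Ioi_of_intervalIntegral_norm_bounded (l := atTop) (b := fun n : ℕ ↦ (n : ℝ)) I 0
      (fun n ↦ (cSs.integrableOn_Icc).mono_set Ioc_subset_Icc_self) tendsto_natCast_atTop_atTop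
      (Eventually.of_forall fun n ↦ ?_)
    have hn : (0 : ℝ) ≤ n := n.cast_nonneg
    have hnorm : (∫ x in (0 : ℝ)..n, ‖∫ θ in (0 : ℝ)..π, ∫ r in (23 / 21 * M)..(8 / 7 * M),
        slabDensity M (Kerr.starPull M Φ) (boxPoint 0 x r θ)‖) =
        ∫ x in (0 : ℝ)..n, ∫ θ in (0 : ℝ)..π, ∫ r in (23 / 21 * M)..(8 / 7 * M),
          slabDensity M (Kerr.starPull M Φ) (boxPoint 0 x r θ) :=
      intervalIntegral.integral_congr fun x _ ↦ by rw [Real.norm_eq_abs, abs_of_nonneg (hS0 x)]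
    rw [hnorm]
    exact hI n hn

/-- **The hypotheses of the energy-to-pointwise reduction hold for the class, given the slab
bound.** With `R₂ = 23M/21`, `τ₀ = 0`: the non-degenerate near-horizon energy
`∫∫_{[M,R₂]×S²} (ψ² + (∂_ρψ)²)(τ)` is bounded uniformly in `τ ≥ 0`, and the degenerate one
`∫∫ (ψ² + (r − M)²(∂_ρψ)²)(τ)` is integrable in `τ ∈ (0, ∞)` — the shell integrals are `2π` times
the box integrals at azimuth `0` (axisymmetry, `density_boxPoint_phi_indep`), which are controlled by
`horizon_bounds_of_class`, `box_sq_weighted_le` and `integrable_slices_of_class`.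
[cite: Aretakis2012, Thm. 2–3 and §15] -/
theorem apexHypotheses_of_class (hM : 0 < M) (hr₀ : r₀ ∈ Set.Ioo 0 M) (hU₀ : IsOpen U₀)
    (hKU : {x : Kerr.region M r₀ | Kerr.rPlus M M ≤ Kerr.radius M (x : E4) ∧ 0 ≤ (x : E4) 0} ⊆ U₀)
    (hΦ : ContDiff ℝ ∞ Φ) (haxi : ∀ (β : ℝ) (z : E4), Φ (E4.axialRotation β z) = Φ z)
    (hsol : ∀ x ∈ U₀, (Kerr.smoothMetric M M r₀).toPseudoRiemannianMetric.dalembertian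
      (fun y : Kerr.region M r₀ ↦ Φ y) x = 0)
    {ρ : ℝ} (hloc : ∀ x ∈ U₀, (x : E4) 0 = 0 → ρ < E4.spatialNorm (x : E4) → Φ x = 0 ∧ fderiv ℝ Φ x = 0)
    {I : ℝ} (hI : ∀ τ : ℝ, 0 ≤ τ → (∫ t in (0 : ℝ)..τ, ∫ θ in (0 : ℝ)..π, ∫ r in (23 / 21 * M)..(8 / 7 * M),
      slabDensity M (Kerr.starPull M Φ) (boxPoint 0 t r θ)) ≤ I) :
    ∃ R₂ τ₀ C : ℝ, M < R₂ ∧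
      (∀ τ : ℝ, τ₀ ≤ τ → shellIntegral M R₂ (fun r θ φ ↦ Real.sin θ *
        (Φ (shellPoint M τ r θ φ) ^ 2 +
          (fderiv ℝ Φ (shellPoint M τ r θ φ) (E4.spaceEmbed (sphRadial θ φ))) ^ 2)) ≤ C) ∧
      IntegrableOn (fun τ ↦ shellIntegral M R₂ (fun r θ φ ↦ Real.sin θ *
        (Φ (shellPoint M τ r θ φ) ^ 2 + (r - M) ^ 2 *
          (fderiv ℝ Φ (shellPoint M τ r θ φ) (E4.spaceEmbed (sphRadial θ φ))) ^ 2))) (Ioi τ₀) := by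
  have hπ : (0 : ℝ) ≤ π := pi_pos.le
  have hMN : M ≤ 23 / 21 * M := by linarith
  have hG : ContDiff ℝ ∞ (Kerr.starPull M Φ) := hΦ.comp (Kerr.contDiff_starChart M)
  have hdiff : Differentiable ℝ Φ := hΦ.differentiable (by simp)
  have hΦ' : ∀ x ∈ U₀, ContDiffAt ℝ ∞ Φ x := fun x _ ↦ hΦ.contDiffAt
  have haxi' : ∀ (β : ℝ) (z : E4), 0 < Kerr.radius M z → Φ (E4.axialRotation β z) = Φ z := fun β z _ ↦ haxi β z
  obtain ⟨-, cS, cK, cL, cG2, cF1, cF2⟩ := continuous_densities hG M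
  obtain ⟨B, hB0, hB⟩ := horizon_bounds_of_class hM hr₀ hU₀ hKU hΦ haxi hsol hloc hI
  obtain ⟨iK, iS⟩ := integrable_slices_of_class hM hr₀ hU₀ hKU hΦ haxi hsol hloc hI
  -- azimuth independence of the two box integrands
  have hind1 : ∀ {τ r θ : ℝ}, 0 ≤ τ → M ≤ r → ∀ φ : ℝ,
      sin ((boxPoint φ τ r θ) 2) * (Kerr.starPull M Φ (boxPoint φ τ r θ) ^ 2 +
        pd 1 (Kerr.starPull M Φ) (boxPoint φ τ r θ) ^ 2) =
      sin ((boxPoint 0 τ r θ) 2) * (Kerr.starPull M Φ (boxPoint 0 τ r θ) ^ 2 +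
        pd 1 (Kerr.starPull M Φ) (boxPoint 0 τ r θ) ^ 2) := by
    intro τ r θ hτ hr φ
    refine density_boxPoint_phi_indep hM hr₀ hU₀ hKU hΦ' haxi' hsol
      (F := fun q ↦ sin (q 2) * (Kerr.starPull M Φ q ^ 2 + pd 1 (Kerr.starPull M Φ) q ^ 2))
      (fun q h ↦ by simp only [h, zero_mul]) (fun q q' _ h2 h3 h4 ↦ by simp only [h2, h3, h4]) hτ hr φ
  have hind2 : ∀ {τ r θ : ℝ}, 0 ≤ τ → M ≤ r → ∀ φ : ℝ,
      sin ((boxPoint φ τ r θ) 2) * (Kerr.starPull M Φ (boxPoint φ τ r θ) ^ 2 +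
        ((boxPoint φ τ r θ) 1 - M) ^ 2 * pd 1 (Kerr.starPull M Φ) (boxPoint φ τ r θ) ^ 2) =
      sin ((boxPoint 0 τ r θ) 2) * (Kerr.starPull M Φ (boxPoint 0 τ r θ) ^ 2 +
        ((boxPoint 0 τ r θ) 1 - M) ^ 2 * pd 1 (Kerr.starPull M Φ) (boxPoint 0 τ r θ) ^ 2) := by
    intro τ r θ hτ hr φ
    refine density_boxPoint_phi_indep hM hr₀ hU₀ hKU hΦ' haxi' hsol
      (F := fun q ↦ sin (q 2) * (Kerr.starPull M Φ q ^ 2 + (q 1 - M) ^ 2 * pd 1 (Kerr.starPull M Φ) q ^ 2))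
      (fun q h ↦ by simp only [h, zero_mul]) (fun q q' h1 h2 h3 h4 ↦ by simp only [h1, h2, h3, h4]) hτ hr φ
  -- the shell integrals are `2π ×` the box integrals at azimuth `0`
  have conv1 : ∀ τ : ℝ, 0 ≤ τ → shellIntegral M (23 / 21 * M) (fun r θ φ ↦ Real.sin θ *
      (Φ (shellPoint M τ r θ φ) ^ 2 + (fderiv ℝ Φ (shellPoint M τ r θ φ) (E4.spaceEmbed (sphRadial θ φ))) ^ 2)) =
      2 * π * ∫ θ in (0 : ℝ)..π, ∫ r in M..(23 / 21 * M), sin θ *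
        (Kerr.starPull M Φ (boxPoint 0 τ r θ) ^ 2 + pd 1 (Kerr.starPull M Φ) (boxPoint 0 τ r θ) ^ 2) := by
    intro τ hτ
    rw [shellIntegral_def]
    have hφ : ∀ φ : ℝ, (∫ θ in (0 : ℝ)..π, ∫ r in M..(23 / 21 * M), Real.sin θ *
        (Φ (shellPoint M τ r θ φ) ^ 2 + (fderiv ℝ Φ (shellPoint M τ r θ φ) (E4.spaceEmbed (sphRadial θ φ))) ^ 2)) =
        ∫ θ in (0 : ℝ)..π, ∫ r in M..(23 / 21 * M), sin θ *
          (Kerr.starPull M Φ (boxPoint 0 τ r θ) ^ 2 + pd 1 (Kerr.starPull M Φ) (boxPoint 0 τ r θ) ^ 2) := by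
      intro φ
      refine intervalIntegral.integral_congr fun θ _ ↦ intervalIntegral.integral_congr fun r hr ↦ ?_
      rw [uIcc_of_le hMN] at hr
      have h := hind1 hτ hr.1 φ (θ := θ)
      simp only [boxPoint_apply_two] at h
      rw [← h, pd_one_starPull_boxPoint (hdiff _), starPull_boxPoint_eq]
    simp_rw [hφ]
    rw [intervalIntegral.integral_const, smul_eq_mul, sub_zero]
  have conv2 : ∀ τ : ℝ, 0 ≤ τ → shellIntegral M (23 / 21 * M) (fun r θ φ ↦ Real.sin θ *
      (Φ (shellPoint M τ r θ φ) ^ 2 + (r - M) ^ 2 *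
        (fderiv ℝ Φ (shellPoint M τ r θ φ) (E4.spaceEmbed (sphRadial θ φ))) ^ 2)) =
      2 * π * ∫ θ in (0 : ℝ)..π, ∫ r in M..(23 / 21 * M), sin θ *
        (Kerr.starPull M Φ (boxPoint 0 τ r θ) ^ 2 + (r - M) ^ 2 * pd 1 (Kerr.starPull M Φ) (boxPoint 0 τ r θ) ^ 2) := by
    intro τ hτ
    rw [shellIntegral_def]
    have hφ : ∀ φ : ℝ, (∫ θ in (0 : ℝ)..π, ∫ r in M..(23 / 21 * M), Real.sin θ *
        (Φ (shellPoint M τ r θ φ) ^ 2 + (r - M) ^ 2 *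
          (fderiv ℝ Φ (shellPoint M τ r θ φ) (E4.spaceEmbed (sphRadial θ φ))) ^ 2)) =
        ∫ θ in (0 : ℝ)..π, ∫ r in M..(23 / 21 * M), sin θ *
          (Kerr.starPull M Φ (boxPoint 0 τ r θ) ^ 2 + (r - M) ^ 2 * pd 1 (Kerr.starPull M Φ) (boxPoint 0 τ r θ) ^ 2) := by
      intro φ
      refine intervalIntegral.integral_congr fun θ _ ↦ intervalIntegral.integral_congr fun r hr ↦ ?_
      rw [uIcc_of_le hMN] at hr
      have h := hind2 hτ hr.1 φ (θ := θ)
      simp only [boxPoint_apply_two, boxPoint_apply_one] at h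
      rw [← h, pd_one_starPull_boxPoint (hdiff _), starPull_boxPoint_eq]
    simp_rw [hφ]
    rw [intervalIntegral.integral_const, smul_eq_mul, sub_zero]
  -- the box integrals at azimuth `0`
  have hK0 : ∀ t, 0 ≤ ∫ θ in (0 : ℝ)..π, ∫ r in M..(23 / 21 * M), nBulkLower M (Kerr.starPull M Φ) (boxPoint 0 t r θ) :=
    fun t ↦ intervalIntegral.integral_nonneg hπ fun θ hθ ↦ intervalIntegral.integral_nonneg hMN fun r hr ↦
      (nEnergyLower_nonneg_of hM _ (q := boxPoint 0 t r θ) (by simpa using hr.1) (by simpa using hθ)).2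
  refine ⟨23 / 21 * M, 0, 2 * π * (B + 16 / M ^ 3 * B), by linarith, fun τ hτ ↦ ?_, ?_⟩
  · -- (i) uniform boundedness
    rw [conv1 τ hτ]
    refine mul_le_mul_of_nonneg_left ?_ (by positivity)
    obtain ⟨h1, h2⟩ := hB τ hτ
    -- `sin θ (G² + G₁²) ≤ sin θ G² + (8/M³) e_low` pointwise, then integrate
    have hU : ∀ {a b : ℝ}, ∀ r ∈ Icc a b, ∀ θ ∈ Icc (0 : ℝ) π, boxPoint 0 τ r θ ∈ (univ : Set E4) :=
      fun _ _ _ _ ↦ mem_univ _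
    have hle := box2_integral_mono (W₀ := univ)
      (F := fun q ↦ sin (q 2) * (Kerr.starPull M Φ q ^ 2 + pd 1 (Kerr.starPull M Φ) q ^ 2))
      (G := fun q ↦ sin (q 2) * Kerr.starPull M Φ q ^ 2 + 8 / M ^ 3 * nEnergyLower M (Kerr.starPull M Φ) q)
      cF1.continuousOn (cG2.add (continuous_const.mul cL)).continuousOn hMN (t := τ) (φ₀ := 0) hU
      (fun r hr θ hθ ↦ by
        have hs : 0 ≤ sin θ := sin_nonneg_of_nonneg_of_le_pi hθ.1 hθ.2
        have hh : 0 ≤ 20 * r - 37 / 2 * M := by linarith [hr.1]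
        have hr0 : 0 ≤ r := hM.le.trans hr.1
        have hS : 0 ≤ r ^ 2 + M ^ 2 * cos θ ^ 2 + 2 * M * r := by positivity
        simp only [nEnergyLower, boxPoint_apply_one, boxPoint_apply_two]
        have hY : 0 ≤ (20 * r - 37 / 2 * M) * (r ^ 2 + M ^ 2 * cos θ ^ 2 + 2 * M * r) / 16 *
            pd 0 (Kerr.starPull M Φ) (boxPoint 0 τ r θ) ^ 2 := by positivity
        have hZ : 0 ≤ 1 / 2 * (20 * r - 37 / 2 * M) * pd 2 (Kerr.starPull M Φ) (boxPoint 0 τ r θ) ^ 2 := by positivity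
        have e : 8 / M ^ 3 * (sin θ * (M ^ 3 / 8 * pd 1 (Kerr.starPull M Φ) (boxPoint 0 τ r θ) ^ 2 +
            (20 * r - 37 / 2 * M) * (r ^ 2 + M ^ 2 * cos θ ^ 2 + 2 * M * r) / 16 *
              pd 0 (Kerr.starPull M Φ) (boxPoint 0 τ r θ) ^ 2 +
            1 / 2 * (20 * r - 37 / 2 * M) * pd 2 (Kerr.starPull M Φ) (boxPoint 0 τ r θ) ^ 2)) =
            sin θ * pd 1 (Kerr.starPull M Φ) (boxPoint 0 τ r θ) ^ 2 + 8 / M ^ 3 * (sin θ *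
              ((20 * r - 37 / 2 * M) * (r ^ 2 + M ^ 2 * cos θ ^ 2 + 2 * M * r) / 16 *
                pd 0 (Kerr.starPull M Φ) (boxPoint 0 τ r θ) ^ 2 +
              1 / 2 * (20 * r - 37 / 2 * M) * pd 2 (Kerr.starPull M Φ) (boxPoint 0 τ r θ) ^ 2)) := by
          field_simp
          ring
        rw [e]
        have hpos : 0 ≤ 8 / M ^ 3 * (sin θ *
            ((20 * r - 37 / 2 * M) * (r ^ 2 + M ^ 2 * cos θ ^ 2 + 2 * M * r) / 16 *
              pd 0 (Kerr.starPull M Φ) (boxPoint 0 τ r θ) ^ 2 +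
            1 / 2 * (20 * r - 37 / 2 * M) * pd 2 (Kerr.starPull M Φ) (boxPoint 0 τ r θ) ^ 2)) := by positivity
        linarith)
    have hsplit := box2_integral_add (W₀ := univ) (F := fun q ↦ sin (q 2) * Kerr.starPull M Φ q ^ 2)
      (G := fun q ↦ 8 / M ^ 3 * nEnergyLower M (Kerr.starPull M Φ) q) cG2.continuousOn
      (continuous_const.mul cL).continuousOn hMN (t := τ) (φ₀ := 0) hU
    simp only [boxPoint_apply_two] at hle hsplit h2
    rw [hsplit] at hle
    have h8' : (∫ θ in (0 : ℝ)..π, ∫ r in M..(23 / 21 * M), 8 / M ^ 3 * nEnergyLower M (Kerr.starPull M Φ) (boxPoint 0 τ r θ)) =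
        8 / M ^ 3 * ∫ θ in (0 : ℝ)..π, ∫ r in M..(23 / 21 * M), nEnergyLower M (Kerr.starPull M Φ) (boxPoint 0 τ r θ) := by
      simp only [intervalIntegral.integral_const_mul]
    rw [h8'] at hle
    have hKL := hK0
    have hKLint : 0 ≤ ∫ t in (0 : ℝ)..τ, ∫ θ in (0 : ℝ)..π, ∫ r in M..(23 / 21 * M),
        nBulkLower M (Kerr.starPull M Φ) (boxPoint 0 t r θ) := intervalIntegral.integral_nonneg hτ fun t _ ↦ hK0 t
    have hL : (∫ θ in (0 : ℝ)..π, ∫ r in M..(23 / 21 * M), nEnergyLower M (Kerr.starPull M Φ) (boxPoint 0 τ r θ)) ≤ 2 * B := by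
      linarith
    have h8 : 8 / M ^ 3 * (∫ θ in (0 : ℝ)..π, ∫ r in M..(23 / 21 * M), nEnergyLower M (Kerr.starPull M Φ) (boxPoint 0 τ r θ)) ≤
        8 / M ^ 3 * (2 * B) := mul_le_mul_of_nonneg_left hL (by positivity)
    calc _ ≤ _ := hle
      _ ≤ B + 8 / M ^ 3 * (2 * B) := by linarith
      _ = B + 16 / M ^ 3 * B := by ring
  · -- (ii) integrability
    have hbox : IntegrableOn (fun τ ↦ ∫ θ in (0 : ℝ)..π, ∫ r in M..(23 / 21 * M), sin θ *
        (Kerr.starPull M Φ (boxPoint 0 τ r θ) ^ 2 + (r - M) ^ 2 * pd 1 (Kerr.starPull M Φ) (boxPoint 0 τ r θ) ^ 2)) (Ioi 0) := by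
      refine integrableOn_Ioi_of_le ((iS.const_mul (7 / M)).add (iK.const_mul 5)) ?_ (fun τ _ ↦ ?_) fun τ _ ↦ ?_
      · have h := continuous_boxSlice cF2 0 M (23 / 21 * M)
        simp only [boxPoint_apply_two, boxPoint_apply_one] at h
        exact h
      · exact intervalIntegral.integral_nonneg hπ fun θ hθ ↦ intervalIntegral.integral_nonneg hMN fun r _ ↦
          mul_nonneg (sin_nonneg_of_nonneg_of_le_pi hθ.1 hθ.2) (by positivity)
      · exact box_sq_weighted_le hM hG τ 0
    have hbox2 : IntegrableOn (fun τ ↦ 2 * π * ∫ θ in (0 : ℝ)..π, ∫ r in M..(23 / 21 * M), sin θ *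
        (Kerr.starPull M Φ (boxPoint 0 τ r θ) ^ 2 + (r - M) ^ 2 * pd 1 (Kerr.starPull M Φ) (boxPoint 0 τ r θ) ^ 2))
        (Ioi 0) := hbox.const_mul (2 * π)
    exact hbox2.congr_fun (fun τ hτ ↦ (conv2 τ (le_of_lt hτ)).symm) measurableSet_Ioi

end Class

end Literature.Barriers.FinalStateConjecture.Kerr

namespace Literature.Barriers.FinalStateConjecture

open Literature.Geometry.Lorentzian
open Literature.Geometry.Lorentzian.Kerr.StarCoord
open Literature.Barriers.FinalStateConjecture.Kerr

/-! ### The reduction -/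

/-- **Aretakis's pointwise decay on extremal Kerr from integrated local energy decay on the
transition slab.** If, for every member of the class of the fact — `ψ ∈ C^∞(E4)` axisymmetric,
solving `□_g ψ = 0` on an open `U₀ ⊇ {r ≥ M, t* ≥ 0}` of the extremal Kerr region `a = M > 0`, with
Cauchy data supported in `|x| ≤ ρ` on `{t* = 0}` — the spacetime integral of
`sin θ (M G² + M³((∂_{t*}G)² + (∂_rG)²) + M(∂_θG)²)` (`G = ψ ∘ κ`, Kerr-star coordinates at
azimuth `0`) over the slabs `[0, τ] × {23M/21 ≤ r ≤ 8M/7} × [0, π]` is bounded uniformly in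
`τ ≥ 0`, then `Aretakis2012_pointwiseDecay` holds. The hypothesis is the integrated local energy
decay statement of Thm. 1 of the source restricted to a compact slab away from the horizon and
from the trapped set; everything else in the proof of Thm. 5 (§§4, 5, 7, 13, 15 of the source) is
carried out in this file and its imports. [cite: Aretakis2012, Thm. 1, Thm. 2, Thm. 5] -/
theorem Aretakis2012_pointwiseDecay_of_slabILED
    (H : ∀ [Kerr.Facts] [Kerr.SliceFacts] (M : ℝ), 0 < M → ∀ r₀ ∈ Set.Ioo 0 M,
      ∀ (U₀ : Set (Kerr.region M r₀)) (Φ : E4 → ℝ), IsOpen U₀ →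
        {x : Kerr.region M r₀ | Kerr.rPlus M M ≤ Kerr.radius M (x : E4) ∧ 0 ≤ (x : E4) 0} ⊆ U₀ →
        ContDiff ℝ ∞ Φ →
        (∀ x ∈ U₀, (Kerr.smoothMetric M M r₀).toPseudoRiemannianMetric.dalembertian
          (fun y : Kerr.region M r₀ ↦ Φ y) x = 0) →
        (∃ ρ : ℝ, ∀ x ∈ U₀, (x : E4) 0 = 0 → ρ < E4.spatialNorm (x : E4) →
          Φ x = 0 ∧ fderiv ℝ Φ x = 0) →
        (∀ (β : ℝ) (z : E4), Φ (E4.axialRotation β z) = Φ z) →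
        ∃ I : ℝ, ∀ τ : ℝ, 0 ≤ τ →
          (∫ t in (0 : ℝ)..τ, ∫ θ in (0 : ℝ)..π, ∫ r in (23 / 21 * M)..(8 / 7 * M),
            slabDensity M (Kerr.starPull M Φ) (boxPoint 0 t r θ)) ≤ I) :
    Aretakis2012_pointwiseDecay := by
  refine Aretakis2012_pointwiseDecay_of_uniformBoundedness_of_integratedDecay ?_
  intro _ _ M hM r₀ hr₀ U₀ Φ hU₀ hKU hΦ hsol hloc haxi
  obtain ⟨I, hI⟩ := H M hM r₀ hr₀ U₀ Φ hU₀ hKU hΦ hsol hloc haxi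
  obtain ⟨ρ, hρ⟩ := hloc
  exact apexHypotheses_of_class hM hr₀ hU₀ hKU hΦ haxi hsol hρ hI


/-- **The same reduction with the slab hypothesis in the language of the fact** (`ψ` and its
derivatives at the points `p(t, r, θ, 0)` of the Kerr–Schild chart along the Kerr-star frame
`T = ∂_{t*}`, `(0, n̂) = ∂_ρ`, `(0, rθ̂ + M cos θ φ̂) = κ_*∂_θ`): if for every member of the class
`∫_0^τ∫₀^π∫_{23M/21}^{8M/7} sin θ (M ψ² + M³((Tψ)² + (∂_ρψ)²) + M((κ_*∂_θ)ψ)²)(p(t, r, θ, 0)) dr dθ dt`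
is bounded uniformly in `τ ≥ 0`, then `Aretakis2012_pointwiseDecay` holds.
[cite: Aretakis2012, Thm. 1, Thm. 2, Thm. 5] -/
theorem Aretakis2012_pointwiseDecay_of_slabILED'
    (H : ∀ [Kerr.Facts] [Kerr.SliceFacts] (M : ℝ), 0 < M → ∀ r₀ ∈ Set.Ioo 0 M,
      ∀ (U₀ : Set (Kerr.region M r₀)) (Φ : E4 → ℝ), IsOpen U₀ →
        {x : Kerr.region M r₀ | Kerr.rPlus M M ≤ Kerr.radius M (x : E4) ∧ 0 ≤ (x : E4) 0} ⊆ U₀ →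
        ContDiff ℝ ∞ Φ →
        (∀ x ∈ U₀, (Kerr.smoothMetric M M r₀).toPseudoRiemannianMetric.dalembertian
          (fun y : Kerr.region M r₀ ↦ Φ y) x = 0) →
        (∃ ρ : ℝ, ∀ x ∈ U₀, (x : E4) 0 = 0 → ρ < E4.spatialNorm (x : E4) →
          Φ x = 0 ∧ fderiv ℝ Φ x = 0) →
        (∀ (β : ℝ) (z : E4), Φ (E4.axialRotation β z) = Φ z) →
        ∃ I : ℝ, ∀ τ : ℝ, 0 ≤ τ →
          (∫ t in (0 : ℝ)..τ, ∫ θ in (0 : ℝ)..π, ∫ r in (23 / 21 * M)..(8 / 7 * M),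
            Real.sin θ * (M * Φ (shellPoint M t r θ 0) ^ 2 +
              M ^ 3 * ((fderiv ℝ Φ (shellPoint M t r θ 0) (E4.basisVector 0)) ^ 2 +
                (fderiv ℝ Φ (shellPoint M t r θ 0) (E4.spaceEmbed (sphRadial θ 0))) ^ 2) +
              M * (fderiv ℝ Φ (shellPoint M t r θ 0)
                (E4.spaceEmbed (r • sphPolar θ 0 + (M * Real.cos θ) • sphAzimuth 0))) ^ 2)) ≤ I) :
    Aretakis2012_pointwiseDecay := by
  refine Aretakis2012_pointwiseDecay_of_slabILED ?_
  intro _ _ M hM r₀ hr₀ U₀ Φ hU₀ hKU hΦ hsol hloc haxi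
  obtain ⟨I, hI⟩ := H M hM r₀ hr₀ U₀ Φ hU₀ hKU hΦ hsol hloc haxi
  refine ⟨I, fun τ hτ ↦ ?_⟩
  have hd : Differentiable ℝ Φ := hΦ.differentiable (by simp)
  have heq : ∀ t r θ : ℝ, slabDensity M (Kerr.starPull M Φ) (boxPoint 0 t r θ) =
      Real.sin θ * (M * Φ (shellPoint M t r θ 0) ^ 2 +
        M ^ 3 * ((fderiv ℝ Φ (shellPoint M t r θ 0) (E4.basisVector 0)) ^ 2 +
          (fderiv ℝ Φ (shellPoint M t r θ 0) (E4.spaceEmbed (sphRadial θ 0))) ^ 2) +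
        M * (fderiv ℝ Φ (shellPoint M t r θ 0)
          (E4.spaceEmbed (r • sphPolar θ 0 + (M * Real.cos θ) • sphAzimuth 0))) ^ 2) := by
    intro t r θ
    simp only [slabDensity, pd_starPull_boxPoint (hd _), Kerr.starFrame_zero, Kerr.starFrame_one,
      Kerr.starFrame_two, boxPoint_apply_one, boxPoint_apply_two, boxPoint_apply_three, starPull_boxPoint_eq]
  simp_rw [heq]
  exact hI τ hτ

end Literature.Barriers.FinalStateConjecture

end
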